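import Mathlib
import HarnessLib
import Literature.Analysis.FluidPDE.VectorCalculus
import Literature.Analysis.FunctionSpaces.SmoothParametricIntegral

/-!
# Route `UnthreadedDoor` / `ThreadingFlux`, crux `PoloidalLiouville` (stmt-NavierStokesRegularity-1222), antidynamo v2 skeleton
# (sha16 `4ebf5683127b`), rung `stub_singleDegreeRung` (BC5): COEFFICIENT REGULARITY ALONG A SPHERICAL PATH FAMILY (census step S2(b), core)

Support file (seat leafhand-ns-unthreadeddoor-1 g0, cell decomp-ns), `--supports stmt-NavierStokesRegularity-1222 --as helper`; theorems only.

The rung's representation `v = gradient φ + (g ‖z‖ · Q z) • z` (pointwise, `φ`, `g` ARBITRARY, Mathlib's junk `gradient`) hides the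
radial coefficient `g` behind a possibly rough potential.  On an open set `U` where `φ` IS differentiable, the tangential part of
`∇φ` equals the tangential part of the smooth field `v`, and this forces `g` to be smooth on the radii swept: integrate `∇φ` along the
spherical paths `τ ↦ r γ(τ)` (`γ` a smooth curve on the unit sphere with `r γ([0,1]) ⊆ U`):
  `I(r) := ∫₀¹ r ⟪v(r γ τ), γ′ τ⟫ dτ = φ(r γ 1) − φ(r γ 0)`     (FTC; the radial part of `∇φ` drops since `γ ⊥ γ′`),
`I` is `C^∞` in `r` (smooth parametric integral), and differentiating the right-hand side in `r` (chain rule at the two endpoints only)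
  `I′(r) = ⟪v(rγ1), γ1⟫ − ⟪v(rγ0), γ0⟫ − r g(r) (Q(rγ1) − Q(rγ0))`.
Hence wherever the two endpoint values of `Q` differ, `g` coincides with a smooth function of `r`.

* `inner_self_deriv_eq_zero_of_norm_eq_one` — `⟪γ τ, γ′ τ⟫ = 0` for a differentiable unit-sphere curve.
* ★ `contDiff_spherePathIntegral` — `r ↦ ∫₀¹ r ⟪v(r γ τ), γ′ τ⟫ dτ` is `C^∞` (`v`, `γ` smooth).
* ★ `spherePathIntegral_eq_sub` — the FTC identity `I(r) = φ(rγ1) − φ(rγ0)` for `r > 0` with `r γ([0,1]) ⊆ U`.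
* ★ `hasDerivAt_spherePathIntegral` — `I′(r) = ⟪v(rγ1),γ1⟫ − ⟪v(rγ0),γ0⟫ − r g r (Q(rγ1) − Q(rγ0))` on an open set of such radii.
* ★★ `exists_contDiffOn_coeff_eq` — if `Q(rγ1) ≠ Q(rγ0)` on that open set `J ⊆ (0,∞)`, there is `ĝ ∈ C^∞(J)` with `g = ĝ` on `J`.

HONEST LABEL: a regularity brick for the plan-only rung (its step S2(b)); nothing here proves the rung, the wall, `PoloidalLiouville`
(1222) or bears on NS regularity.  [folklore]
-/

noncomputable section

-- the summit and its single sub-problem share the name (CONVENTIONS §1)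
set_option linter.dupNamespace false

open scoped Topology InnerProductSpace RealInnerProductSpace ContDiff
open Filter Set Function Metric MeasureTheory intervalIntegral
open Literature.Analysis.FluidPDE

namespace Summit.NavierStokesRegularity.NavierStokesRegularity.Theorems.PoloidalLiouville.Antidynamo

/-- A differentiable curve on the unit sphere is orthogonal to its velocity: `⟪γ τ, γ′ τ⟫ = 0`. [folklore] -/
theorem inner_self_deriv_eq_zero_of_norm_eq_one {γ : ℝ → EuclideanSpace ℝ (Fin 3)} (hγd : Differentiable ℝ γ)
    (hγ1 : ∀ τ, ‖γ τ‖ = 1) (τ : ℝ) : ⟪γ τ, deriv γ τ⟫ = 0 := by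
  have h1 : HasDerivAt (fun t => ⟪γ t, γ t⟫) (⟪γ τ, deriv γ τ⟫ + ⟪deriv γ τ, γ τ⟫) τ :=
    (hγd τ).hasDerivAt.inner ℝ (hγd τ).hasDerivAt
  have h2 : HasDerivAt (fun t => ⟪γ t, γ t⟫) 0 τ := by
    have : (fun t => ⟪γ t, γ t⟫) = fun _ => (1 : ℝ) := by
      funext t; rw [real_inner_self_eq_norm_sq, hγ1, one_pow]
    rw [this]; exact hasDerivAt_const τ 1
  have h3 := h1.unique h2
  rw [real_inner_comm (γ τ) (deriv γ τ)] at h3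
  linarith

/-- ★ The spherical path integral `r ↦ ∫₀¹ r ⟪v(r γ τ), γ′ τ⟫ dτ` is `C^∞` for smooth `v` and a smooth curve `γ`. [folklore] -/
theorem contDiff_spherePathIntegral {v : EuclideanSpace ℝ (Fin 3) → EuclideanSpace ℝ (Fin 3)} (hv : ContDiff ℝ ∞ v)
    {γ : ℝ → EuclideanSpace ℝ (Fin 3)} (hγ : ContDiff ℝ ∞ γ) :
    ContDiff ℝ ∞ fun r : ℝ => ∫ τ in (0 : ℝ)..1, r * ⟪v (r • γ τ), deriv γ τ⟫ := by
  have hdγ : ContDiff ℝ ∞ (deriv γ) := (contDiff_infty_iff_deriv.1 hγ).2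
  have hH : ContDiff ℝ ∞ fun q : ℝ × ℝ => q.2 * ⟪v (q.2 • γ q.1), deriv γ q.1⟫ :=
    contDiff_snd.mul ((hv.comp (contDiff_snd.smul (hγ.comp contDiff_fst))).inner ℝ (hdγ.comp contDiff_fst))
  exact Literature.Analysis.FunctionSpaces.contDiff_parametric_intervalIntegral hH 0 1

/-- ★ FTC ALONG A SPHERICAL PATH.  If `φ` is differentiable on `U` with `∇φ = v − (g ‖z‖ · Q z) • z` there, `γ` is a differentiable unit
curve with continuous velocity and `r γ([0,1]) ⊆ U`, then `∫₀¹ r ⟪v(r γ τ), γ′ τ⟫ dτ = φ(r γ 1) − φ(r γ 0)` (the radial part of `∇φ`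
is invisible along the sphere). [folklore] -/
theorem spherePathIntegral_eq_sub {v : EuclideanSpace ℝ (Fin 3) → EuclideanSpace ℝ (Fin 3)} (hv : Continuous v)
    {φ : EuclideanSpace ℝ (Fin 3) → ℝ} {g : ℝ → ℝ} {Q : EuclideanSpace ℝ (Fin 3) → ℝ} {U : Set (EuclideanSpace ℝ (Fin 3))}
    (hφ : ∀ z ∈ U, DifferentiableAt ℝ φ z) (hrep : ∀ z ∈ U, gradient φ z = v z - (g ‖z‖ * Q z) • z)
    {γ : ℝ → EuclideanSpace ℝ (Fin 3)} (hγd : Differentiable ℝ γ) (hγc : Continuous (deriv γ)) (hγ1 : ∀ τ, ‖γ τ‖ = 1)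
    {r : ℝ} (hrU : ∀ τ ∈ Icc (0 : ℝ) 1, r • γ τ ∈ U) :
    ∫ τ in (0 : ℝ)..1, r * ⟪v (r • γ τ), deriv γ τ⟫ = φ (r • γ 1) - φ (r • γ 0) := by
  have hderiv : ∀ τ ∈ uIcc (0 : ℝ) 1, HasDerivAt (fun t => φ (r • γ t)) (r * ⟪v (r • γ τ), deriv γ τ⟫) τ := by
    intro τ hτ
    rw [uIcc_of_le zero_le_one] at hτ
    have hzU : r • γ τ ∈ U := hrU τ hτ
    have hin : HasDerivAt (fun t => r • γ t) (r • deriv γ τ) τ := (hγd τ).hasDerivAt.const_smul r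
    have hφ' : HasFDerivAt φ
        ((InnerProductSpace.toDual ℝ (EuclideanSpace ℝ (Fin 3))) (gradient φ (r • γ τ))) (r • γ τ) :=
      (hφ _ hzU).hasGradientAt.hasFDerivAt
    have hcomp := hφ'.comp_hasDerivAt τ hin
    refine hcomp.congr_deriv ?_
    rw [InnerProductSpace.toDual_apply_apply, hrep _ hzU, inner_sub_left, real_inner_smul_left, inner_smul_right,
      inner_smul_left, inner_smul_right, inner_self_deriv_eq_zero_of_norm_eq_one hγd hγ1 τ]
    simp
  have hvc : Continuous fun τ => v (r • γ τ) := hv.comp (hγd.continuous.const_smul r)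
  have hcont : Continuous fun τ => r * ⟪v (r • γ τ), deriv γ τ⟫ :=
    continuous_const.mul (hvc.inner hγc)
  rw [integral_eq_sub_of_hasDerivAt hderiv (hcont.intervalIntegrable _ _)]

/-- ★ DERIVATIVE OF THE SPHERICAL PATH INTEGRAL IN THE RADIUS.  On an open set `J ⊆ (0,∞)` of radii with `r γ([0,1]) ⊆ U` for `r ∈ J`,
`I(r) = ∫₀¹ r ⟪v(rγτ), γ′τ⟫ dτ` has derivative `⟪v(rγ1), γ1⟫ − ⟪v(rγ0), γ0⟫ − r g(r) (Q(rγ1) − Q(rγ0))` (chain rule at the two endpoints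
of `I(r) = φ(rγ1) − φ(rγ0)`). [folklore] -/
theorem hasDerivAt_spherePathIntegral {v : EuclideanSpace ℝ (Fin 3) → EuclideanSpace ℝ (Fin 3)} (hv : Continuous v)
    {φ : EuclideanSpace ℝ (Fin 3) → ℝ} {g : ℝ → ℝ} {Q : EuclideanSpace ℝ (Fin 3) → ℝ} {U : Set (EuclideanSpace ℝ (Fin 3))}
    (hφ : ∀ z ∈ U, DifferentiableAt ℝ φ z) (hrep : ∀ z ∈ U, gradient φ z = v z - (g ‖z‖ * Q z) • z)
    {γ : ℝ → EuclideanSpace ℝ (Fin 3)} (hγd : Differentiable ℝ γ) (hγc : Continuous (deriv γ)) (hγ1 : ∀ τ, ‖γ τ‖ = 1)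
    {J : Set ℝ} (hJ : IsOpen J) (hJpos : ∀ r ∈ J, 0 < r) (hJU : ∀ r ∈ J, ∀ τ ∈ Icc (0 : ℝ) 1, r • γ τ ∈ U)
    {r : ℝ} (hr : r ∈ J) :
    HasDerivAt (fun s : ℝ => ∫ τ in (0 : ℝ)..1, s * ⟪v (s • γ τ), deriv γ τ⟫)
      (⟪v (r • γ 1), γ 1⟫ - ⟪v (r • γ 0), γ 0⟫ - r * g r * (Q (r • γ 1) - Q (r • γ 0))) r := by
  -- `I = φ(· γ 1) − φ(· γ 0)` near `r`
  have hev : (fun s : ℝ => ∫ τ in (0 : ℝ)..1, s * ⟪v (s • γ τ), deriv γ τ⟫) =ᶠ[𝓝 r]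
      fun s => φ (s • γ 1) - φ (s • γ 0) := by
    filter_upwards [hJ.mem_nhds hr] with s hs using spherePathIntegral_eq_sub hv hφ hrep hγd hγc hγ1 (hJU s hs)
  -- derivative of `s ↦ φ (s • γ i)` at `r`
  have hend : ∀ τ ∈ Icc (0 : ℝ) 1, HasDerivAt (fun s : ℝ => φ (s • γ τ)) (⟪v (r • γ τ), γ τ⟫ - r * g r * Q (r • γ τ)) r := by
    intro τ hτ
    have hzU : r • γ τ ∈ U := hJU r hr τ hτ
    have hin : HasDerivAt (fun s : ℝ => s • γ τ) (γ τ) r := by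
      simpa using (hasDerivAt_id r).smul_const (γ τ)
    have hφ' : HasFDerivAt φ
        ((InnerProductSpace.toDual ℝ (EuclideanSpace ℝ (Fin 3))) (gradient φ (r • γ τ))) (r • γ τ) :=
      (hφ _ hzU).hasGradientAt.hasFDerivAt
    have hcomp := hφ'.comp_hasDerivAt r hin
    refine hcomp.congr_deriv ?_
    have hnorm : ‖r • γ τ‖ = r := by
      rw [norm_smul, Real.norm_eq_abs, abs_of_pos (hJpos r hr), hγ1, mul_one]
    rw [InnerProductSpace.toDual_apply_apply, hrep _ hzU, inner_sub_left, real_inner_smul_left, inner_smul_left,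
      real_inner_self_eq_norm_sq, hγ1, hnorm]
    simp; ring
  have h1 := hend 1 ⟨zero_le_one, le_rfl⟩
  have h0 := hend 0 ⟨le_rfl, zero_le_one⟩
  refine ((h1.sub h0).congr_of_eventuallyEq hev).congr_deriv ?_
  ring

/-- ★★ COEFFICIENT REGULARITY.  In the situation of `hasDerivAt_spherePathIntegral`, with `v` smooth and `Q` smooth, if the endpoint
values separate the coefficient (`Q(rγ1) ≠ Q(rγ0)` for `r ∈ J`), then the (arbitrary!) radial coefficient `g` coincides on `J` with a
`C^∞` function: `g r = (⟪v(rγ1),γ1⟫ − ⟪v(rγ0),γ0⟫ − I′(r)) / (r (Q(rγ1) − Q(rγ0)))`. [folklore] -/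
theorem exists_contDiffOn_coeff_eq {v : EuclideanSpace ℝ (Fin 3) → EuclideanSpace ℝ (Fin 3)} (hv : ContDiff ℝ ∞ v)
    {φ : EuclideanSpace ℝ (Fin 3) → ℝ} {g : ℝ → ℝ} {Q : EuclideanSpace ℝ (Fin 3) → ℝ} (hQ : ContDiff ℝ ∞ Q)
    {U : Set (EuclideanSpace ℝ (Fin 3))}
    (hφ : ∀ z ∈ U, DifferentiableAt ℝ φ z) (hrep : ∀ z ∈ U, gradient φ z = v z - (g ‖z‖ * Q z) • z)
    {γ : ℝ → EuclideanSpace ℝ (Fin 3)} (hγ : ContDiff ℝ ∞ γ) (hγ1 : ∀ τ, ‖γ τ‖ = 1)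
    {J : Set ℝ} (hJ : IsOpen J) (hJpos : ∀ r ∈ J, 0 < r) (hJU : ∀ r ∈ J, ∀ τ ∈ Icc (0 : ℝ) 1, r • γ τ ∈ U)
    (hsep : ∀ r ∈ J, Q (r • γ 1) ≠ Q (r • γ 0)) :
    ∃ ĝ : ℝ → ℝ, ContDiffOn ℝ ∞ ĝ J ∧ ∀ r ∈ J, g r = ĝ r := by
  have hγd : Differentiable ℝ γ := hγ.differentiable (by simp)
  have hγc : Continuous (deriv γ) := hγ.continuous_deriv (by simp)
  set I : ℝ → ℝ := fun s => ∫ τ in (0 : ℝ)..1, s * ⟪v (s • γ τ), deriv γ τ⟫ with hI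
  have hIs : ContDiff ℝ ∞ I := contDiff_spherePathIntegral hv hγ
  have hdI : ContDiff ℝ ∞ (deriv I) := (contDiff_infty_iff_deriv.1 hIs).2
  set N : ℝ → ℝ := fun s => ⟪v (s • γ 1), γ 1⟫ - ⟪v (s • γ 0), γ 0⟫ with hN
  set Δ : ℝ → ℝ := fun s => Q (s • γ 1) - Q (s • γ 0) with hΔ
  refine ⟨fun s => (N s - deriv I s) / (s * Δ s), ?_, ?_⟩
  · have hNs : ContDiff ℝ ∞ N :=
      ((hv.comp (contDiff_id.smul contDiff_const)).inner ℝ contDiff_const).sub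
        ((hv.comp (contDiff_id.smul contDiff_const)).inner ℝ contDiff_const)
    have hΔs : ContDiff ℝ ∞ Δ :=
      (hQ.comp (contDiff_id.smul contDiff_const)).sub (hQ.comp (contDiff_id.smul contDiff_const))
    refine ((hNs.sub hdI).contDiffOn).div ((contDiff_id.mul hΔs).contDiffOn) fun s hs => ?_
    exact mul_ne_zero (hJpos s hs).ne' (sub_ne_zero.2 (hsep s hs))
  · intro r hr
    have hD := (hasDerivAt_spherePathIntegral hv.continuous hφ hrep hγd hγc hγ1 hJ hJpos hJU hr).deriv
    have hne : r * Δ r ≠ 0 := mul_ne_zero (hJpos r hr).ne' (sub_ne_zero.2 (hsep r hr))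
    rw [eq_div_iff hne]
    simp only [hN, hΔ, hI] at hD ⊢
    rw [hD]
    ring

end Summit.NavierStokesRegularity.NavierStokesRegularity.Theorems.PoloidalLiouville.Antidynamo

end
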